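import Summits.HodgeConjecture.HodgeConjecture.Theorems.Q8SymplecticPowersMatchingFreeSlots
import Literature.RepresentationTheory.ClassicalInvariants.TensorFFTLetterColoured
import HarnessLib

/-!
# Route `Q8SymplecticPowers`, programme K2Q ∕ F-Q — brick F2b: **slicing a coefficient tensor on the alphabet `A_N ⊕ A_T`
# by its `N`-profile** — the block group `1 ⊕ g` acts slice by slice, and slices reassemble into matching tensors with
# free slots

Support file for crux K2Q `PowersHodgeOfQuaternionCommutators` (stmt-HodgeConjecture-24191; `--supports … --as helper`;
nothing here closes an item). Prover seat `hodge-nonav-20241-p1` (g21). Pure combinatorics of coefficient tensors over a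
field `K`.

In an adapted basis `N ⊕ T` of `H²` (`N` = the Hodge classes, fixed pointwise by the route's group `Uni`; `T` its
orthogonal), an element of `Uni` has matrix `fromBlocks 1 0 0 g`. A word `w : P → A_N ⊕ A_T` has an `N`-PROFILE
`prof w : P → Option A_N` (`some x` at the positions carrying the `N`-letter `x`, `none` at the `T`-positions) and
`T`-LETTERS `tl w : {p // prof w p = none} → A_T`; conversely `join η u` is the word with profile `η` and `T`-letters `u`.

* §1 `prof_join`, `join_tl` (`join (prof w) (tl w) = w`), `join_injective`;
* §2 **`sum_prod_fromBlocks_one_join`** — the Kronecker power of `fromBlocks 1 0 0 g` maps the slice of profile `η` to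
  itself, acting by `g^{⊗(T-positions)}`: `Σ_w (∏_p (1 ⊕ g)(join η u p, w p)) c(w) = Σ_{u₂} (∏_q g(u q, u₂ q)) c(join η u₂)`;
  hence every slice `u ↦ c(join η u)` of an invariant tensor is `g`-invariant (`slice_invariant`), also after enumerating
  the `T`-positions by `Fin m` (`slice_invariant_fin`, the shape the ascent ∕ FFT bricks consume);
* §3 reassembly (with the `T`-positions of each profile enumerated, `σ : Fin m ≃ {p // η p = none}`):
  `c = Σ_η Σ_v c(join η (v ∘ σ⁻¹)) • δ_{join η (v ∘ σ⁻¹)}` (`eq_sum_sum_smul_indicator`), the push-forward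
  `f ↦ Σ_v f(v) • δ_{join η (v ∘ σ⁻¹)}` preserves spans (`sum_smul_indicator_mem_span`), and
  **`sum_taggedContraction_smul_indicator`**: the push-forward of a tagged contraction of `Fin m` is the MATCHING
  COEFFICIENT TENSOR WITH FREE SLOTS (brick F2a) whose pairs carry the zero-extended matrices `fromBlocks 0 0 0 Θ_d` and
  whose free slots, the `N`-positions, carry the indicator vectors of their `N`-letters.

HONEST FRAMING: combinatorics only (axioms standard); item 24191 OPEN; nothing here says HC ∕ HC_CM ∕ HC_AV is proved.

## References

* R. Goodman, N. Wallach, *Symmetry, Representations, and Invariants*, GTM 255, §4.1.1, §4.2.2 Prop. 4.2.5 (invariants of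
  a group acting on some tensor factors only), §5.3.2. [cite: GoodmanWallachGTM255]
-/

set_option linter.dupNamespace false

noncomputable section

open scoped BigOperators Matrix

namespace Summit.HodgeConjecture.HodgeConjecture.Theorems.Q8SymplecticPowersBlockSlices

open Literature.RepresentationTheory.ClassicalInvariants (taggedContraction taggedContraction_apply
  sum_eq_sum_comp_of_injective)

universe u

variable {K : Type u} [Field K] {AN AT : Type*} {P : Type*}

/-! ### §1 Profiles, `T`-letters and `join` -/

/-- The `N`-profile of a word: `some x` at the positions with `N`-letter `x`, `none` at the `T`-positions.
[cite: GoodmanWallachGTM255, §4.2.2 Prop. 4.2.5] -/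
def prof (w : P → AN ⊕ AT) : P → Option AN := fun p => Sum.getLeft? (w p)

/-- The `T`-letters of a word, on the positions where its profile is `none`. [cite: GoodmanWallachGTM255, §4.2.2 Prop. 4.2.5] -/
def tl (w : P → AN ⊕ AT) (q : {p // prof w p = none}) : AT :=
  Sum.getRight (w q.1) (Sum.getLeft?_eq_none_iff.mp q.2)

/-- The word with `N`-profile `η` and `T`-letters `u`. [cite: GoodmanWallachGTM255, §4.2.2 Prop. 4.2.5] -/
def join (η : P → Option AN) (u : {p // η p = none} → AT) (p : P) : AN ⊕ AT :=
  if h : η p = none then Sum.inr (u ⟨p, h⟩) else Sum.inl (Option.get (η p) (Option.ne_none_iff_isSome.mp h))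

/-- `join η u` has an `inr`-letter at the `T`-positions of `η`. [folklore] -/
theorem join_apply_of_eq_none (η : P → Option AN) (u : {p // η p = none} → AT) (q : {p // η p = none}) :
    join η u q.1 = Sum.inr (u q) := by
  rw [join, dif_pos q.2]

/-- `join η u` has the `inl`-letter `x` at a position with `η p = some x`. [folklore] -/
theorem join_apply_of_eq_some (η : P → Option AN) (u : {p // η p = none} → AT) {p : P} {x : AN} (h : η p = some x) :
    join η u p = Sum.inl x := by
  obtain ⟨h', hget⟩ := Option.eq_some_iff_get_eq.mp h
  have hne : η p ≠ none := by rw [h]; exact Option.some_ne_none x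
  rw [join, dif_neg hne]
  exact congrArg Sum.inl hget

/-- The profile of `join η u` is `η`. [folklore] -/
theorem prof_join (η : P → Option AN) (u : {p // η p = none} → AT) : prof (join η u) = η := by
  funext p
  show Sum.getLeft? (join η u p) = η p
  by_cases h : η p = none
  · rw [join_apply_of_eq_none η u ⟨p, h⟩, h, Sum.getLeft?_inr]
  · obtain ⟨x, hx⟩ := Option.ne_none_iff_exists'.mp h
    rw [join_apply_of_eq_some η u hx, hx, Sum.getLeft?_inl]

/-- `join (prof w) (tl w) = w`. [folklore] -/
theorem join_tl (w : P → AN ⊕ AT) : join (prof w) (tl w) = w := by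
  funext p
  by_cases h : prof w p = none
  · rw [join_apply_of_eq_none _ _ ⟨p, h⟩]
    exact Sum.inr_getRight _ _
  · obtain ⟨x, hx⟩ := Option.ne_none_iff_exists'.mp h
    rw [join_apply_of_eq_some _ _ hx]
    exact (Sum.getLeft?_eq_some_iff.mp hx).symm

/-- `join η` is injective in the `T`-letters. [folklore] -/
theorem join_injective (η : P → Option AN) : Function.Injective (join (AT := AT) η) := by
  intro u u' h
  funext q
  have hq := congr_fun h q.1
  rw [join_apply_of_eq_none, join_apply_of_eq_none] at hq
  exact Sum.inr_injective hq

/-- A word whose letters at the `T`-positions of `η` are `inr`-letters and whose letters at the other positions are the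
`inl`-letters prescribed by `η` lies on the slice of `η`. [folklore] -/
theorem exists_eq_join (η : P → Option AN) (w : P → AN ⊕ AT) (hT : ∀ q : {p // η p = none}, ∃ y, w q.1 = Sum.inr y)
    (hN : ∀ (p : P) (x : AN), η p = some x → w p = Sum.inl x) : ∃ u, w = join η u := by
  choose y hy using hT
  refine ⟨y, funext fun p => ?_⟩
  by_cases h : η p = none
  · rw [join_apply_of_eq_none η y ⟨p, h⟩, hy ⟨p, h⟩]
  · obtain ⟨x, hx⟩ := Option.ne_none_iff_exists'.mp h
    rw [join_apply_of_eq_some _ _ hx, hN p x hx]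

/-- An entry of `fromBlocks 0 0 0 D` with an `inl` row or column index vanishes. [folklore] -/
theorem fromBlocks_zero_apply_eq_zero (D : Matrix AT AT K) {x y : AN ⊕ AT} (h : x.isLeft = true ∨ y.isLeft = true) :
    Matrix.fromBlocks (0 : Matrix AN AN K) 0 0 D x y = 0 := by
  rcases x with x | x <;> rcases y with y | y
  · rw [Matrix.fromBlocks_apply₁₁, Matrix.zero_apply]
  · rw [Matrix.fromBlocks_apply₁₂, Matrix.zero_apply]
  · rw [Matrix.fromBlocks_apply₂₁, Matrix.zero_apply]
  · simp only [Sum.isLeft_inr, Bool.false_eq_true, or_self] at h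

/-! ### §2 The block group `1 ⊕ g` acts slice by slice -/

section Kernel

variable [Fintype P] [DecidableEq P] [Fintype AN] [DecidableEq AN] [Fintype AT] [DecidableEq AT]

/-- **The Kronecker power of `fromBlocks 1 0 0 g` on the slice of profile `η`**: for `w' = join η u`,
`Σ_w (∏_p (1 ⊕ g)(w' p, w p)) c(w) = Σ_{u₂} (∏_q g (u q) (u₂ q)) c(join η u₂)` — words of a different profile contribute
`0`, and on the slice the kernel is `g^{⊗(T-positions)}`. [cite: GoodmanWallachGTM255, §4.2.2 Prop. 4.2.5 and §4.1.1] -/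
theorem sum_prod_fromBlocks_one_join (g : Matrix AT AT K) (c : (P → AN ⊕ AT) → K) (η : P → Option AN)
    (u : {p // η p = none} → AT) :
    (∑ w : P → AN ⊕ AT, (∏ p, Matrix.fromBlocks (1 : Matrix AN AN K) 0 0 g (join η u p) (w p)) * c w) =
      ∑ u₂ : {p // η p = none} → AT, (∏ q : {p // η p = none}, g (u q) (u₂ q)) * c (join η u₂) := by
  classical
  rw [sum_eq_sum_comp_of_injective (join (AT := AT) η) (join_injective η)]
  · refine Finset.sum_congr rfl fun u₂ _ => ?_
    congr 1
    rw [← Fintype.prod_subtype_mul_prod_subtype (fun p => η p = none)]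
    have h1 : (∏ q : {p // η p = none}, Matrix.fromBlocks (1 : Matrix AN AN K) 0 0 g (join η u q.1) (join η u₂ q.1)) =
        ∏ q : {p // η p = none}, g (u q) (u₂ q) :=
      Finset.prod_congr rfl fun q _ => by rw [join_apply_of_eq_none, join_apply_of_eq_none, Matrix.fromBlocks_apply₂₂]
    have h2 : (∏ q : {p // ¬η p = none}, Matrix.fromBlocks (1 : Matrix AN AN K) 0 0 g (join η u q.1) (join η u₂ q.1)) = 1 :=
      Finset.prod_eq_one fun q _ => by
        obtain ⟨x, hx⟩ := Option.ne_none_iff_exists'.mp q.2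
        rw [join_apply_of_eq_some _ _ hx, join_apply_of_eq_some _ _ hx, Matrix.fromBlocks_apply₁₁, Matrix.one_apply_eq]
    rw [h1, h2, mul_one]
  · -- words off the slice: some kernel entry vanishes
    intro w hw
    suffices h : ∃ p, Matrix.fromBlocks (1 : Matrix AN AN K) 0 0 g (join η u p) (w p) = 0 by
      obtain ⟨p, hp⟩ := h
      rw [Finset.prod_eq_zero (Finset.mem_univ p) hp, zero_mul]
    by_contra hall
    push Not at hall
    have key : ∃ u', w = join η u' := by
      refine exists_eq_join η w (fun q => ?_) (fun p x hx => ?_)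
      · rcases hwq : w q.1 with x | y
        · exact absurd (by rw [join_apply_of_eq_none η u q, hwq, Matrix.fromBlocks_apply₂₁, Matrix.zero_apply]) (hall q.1)
        · exact ⟨y, rfl⟩
      · rcases hwp : w p with x' | y'
        · have hne := hall p
          rw [join_apply_of_eq_some _ _ hx, hwp, Matrix.fromBlocks_apply₁₁] at hne
          by_contra hxx
          exact hne (Matrix.one_apply_ne fun h' => hxx (by rw [h']))
        · exact absurd (by rw [join_apply_of_eq_some _ _ hx, hwp, Matrix.fromBlocks_apply₁₂, Matrix.zero_apply]) (hall p)
    obtain ⟨u', hu'⟩ := key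
    exact hw ⟨u', hu'.symm⟩

/-- **Every slice of an invariant coefficient tensor is invariant** under `g` on its `T`-positions.
[cite: GoodmanWallachGTM255, §4.2.2 Prop. 4.2.5] -/
theorem slice_invariant (g : Matrix AT AT K) (c : (P → AN ⊕ AT) → K)
    (hc : ∀ w' : P → AN ⊕ AT, (∑ w, (∏ p, Matrix.fromBlocks (1 : Matrix AN AN K) 0 0 g (w' p) (w p)) * c w) = c w')
    (η : P → Option AN) (u : {p // η p = none} → AT) :
    (∑ u₂ : {p // η p = none} → AT, (∏ q : {p // η p = none}, g (u q) (u₂ q)) * c (join η u₂)) = c (join η u) := by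
  rw [← sum_prod_fromBlocks_one_join]
  exact hc _

/-- **Slice invariance transported to `Fin m` positions** (`σ : Fin m ≃` the `T`-positions): the function
`v ↦ c(join η (v ∘ σ⁻¹))` on `Fin m → A_T` is fixed by the Kronecker power `g^{⊗m}` (vector convention).
[cite: GoodmanWallachGTM255, §4.2.2 Prop. 4.2.5] -/
theorem slice_invariant_fin (g : Matrix AT AT K) (c : (P → AN ⊕ AT) → K)
    (hc : ∀ w' : P → AN ⊕ AT, (∑ w, (∏ p, Matrix.fromBlocks (1 : Matrix AN AN K) 0 0 g (w' p) (w p)) * c w) = c w')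
    (η : P → Option AN) {m : ℕ} (σ : Fin m ≃ {p // η p = none}) (v : Fin m → AT) :
    (∑ v₂ : Fin m → AT, (∏ t, g (v t) (v₂ t)) * c (join η fun q => v₂ (σ.symm q))) = c (join η fun q => v (σ.symm q)) := by
  rw [← slice_invariant g c hc η (fun q => v (σ.symm q))]
  refine Fintype.sum_equiv (Equiv.arrowCongr σ (Equiv.refl AT)) _ _ fun v₂ => ?_
  have harrow : (Equiv.arrowCongr σ (Equiv.refl AT)) v₂ = fun q => v₂ (σ.symm q) := rfl
  rw [harrow]
  congr 1
  exact Fintype.prod_equiv σ _ _ fun t => by simp only [Equiv.symm_apply_apply]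

end Kernel

/-! ### §3 Reassembly into matching coefficient tensors with free slots -/

section Reassembly

variable [Fintype P] [DecidableEq P] [DecidableEq AN] [Fintype AT] [DecidableEq AT]

/-- **A coefficient tensor is the sum over profiles and `T`-letters of its values times indicators** (the `T`-positions of
each profile enumerated by `σ η : Fin (m η) ≃ {p // η p = none}`). [cite: GoodmanWallachGTM255, §4.1.1] -/
theorem eq_sum_sum_smul_indicator [Fintype AN] (c : (P → AN ⊕ AT) → K) (m : (P → Option AN) → ℕ)
    (σ : ∀ η : P → Option AN, Fin (m η) ≃ {p // η p = none}) :
    c = ∑ η : P → Option AN, ∑ v : Fin (m η) → AT,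
      c (join η fun q => v ((σ η).symm q)) • (fun w => if w = join η (fun q => v ((σ η).symm q)) then (1 : K) else 0) := by
  classical
  funext w
  rw [Finset.sum_apply, Finset.sum_eq_single_of_mem (prof w) (Finset.mem_univ _)]
  · rw [Finset.sum_apply, Finset.sum_eq_single_of_mem (fun t => tl w (σ (prof w) t)) (Finset.mem_univ _)]
    · have hw : (join (prof w) fun q => (fun t => tl w (σ (prof w) t)) ((σ (prof w)).symm q)) = w := by
        conv_rhs => rw [← join_tl w]
        exact congrArg (join (prof w)) (funext fun q => by simp only [Equiv.apply_symm_apply])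
      rw [hw, Pi.smul_apply, smul_eq_mul, if_pos rfl, mul_one]
    · intro v _ hv
      rw [Pi.smul_apply, smul_eq_mul, if_neg, mul_zero]
      intro hwv
      apply hv
      funext t
      have h := congr_fun (join_injective (prof w) ((join_tl w).trans hwv)) (σ (prof w) t)
      rw [Equiv.symm_apply_apply] at h
      exact h.symm
  · intro η _ hη
    rw [Finset.sum_apply]
    refine Finset.sum_eq_zero fun v _ => ?_
    rw [Pi.smul_apply, smul_eq_mul, if_neg, mul_zero]
    intro hwv
    apply hη
    rw [hwv, prof_join]

omit [DecidableEq P] in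
/-- **The push-forward `f ↦ Σ_v f(v) • δ_{join η (v ∘ σ⁻¹)}` preserves spans.** [cite: GoodmanWallachGTM255, §4.1.1] -/
theorem sum_smul_indicator_mem_span (η : P → Option AN) {m : ℕ} (σ : Fin m ≃ {p // η p = none})
    {S : Set ((Fin m → AT) → K)} {f : (Fin m → AT) → K} (hf : f ∈ Submodule.span K S) :
    (∑ v : Fin m → AT, f v • (fun w : P → AN ⊕ AT => if w = join η (fun q => v (σ.symm q)) then (1 : K) else 0)) ∈
      Submodule.span K ((fun s : (Fin m → AT) → K =>
        ∑ v : Fin m → AT, s v • (fun w : P → AN ⊕ AT => if w = join η (fun q => v (σ.symm q)) then (1 : K) else 0)) '' S) := by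
  classical
  let L : ((Fin m → AT) → K) →ₗ[K] ((P → AN ⊕ AT) → K) :=
    { toFun := fun s => ∑ v : Fin m → AT, s v • (fun w : P → AN ⊕ AT =>
        if w = join η (fun q => v (σ.symm q)) then (1 : K) else 0)
      map_add' := fun s s' => by simp only [Pi.add_apply, add_smul, Finset.sum_add_distrib]
      map_smul' := fun r s => by simp only [Pi.smul_apply, smul_eq_mul, mul_smul, Finset.smul_sum, RingHom.id_apply] }
  have h := Submodule.mem_map_of_mem (f := L) hf
  rw [Submodule.map_span] at h
  exact h

/-- **The push-forward of a tagged contraction of `Fin m` is a matching coefficient tensor with free slots**: the pairs sit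
at the `T`-positions `σ (e⁻¹ (i, c))` and carry the zero-extended matrices `fromBlocks 0 0 0 (Θ d)`; the free slots — the
`N`-positions, enumerated by `τN` — carry the indicator vectors of their `N`-letters.
[cite: GoodmanWallachGTM255, §5.3.2 and §4.2.2 Prop. 4.2.5] -/
theorem sum_taggedContraction_smul_indicator {ι : Type*} (Θ : ι → Matrix AT AT K) (η : P → Option AN) {m j l : ℕ}
    (σ : Fin m ≃ {p // η p = none}) (e : Fin m ≃ Fin 2 × Fin j) (τN : {p // ¬η p = none} ≃ Fin l) (δ : Fin j → ι) :
    (∑ v : Fin m → AT, taggedContraction Θ e δ v •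
        (fun w : P → AN ⊕ AT => if w = join η (fun q => v (σ.symm q)) then (1 : K) else 0)) =
      fun w => (∏ c, Matrix.fromBlocks (0 : Matrix AN AN K) 0 0 (Θ (δ c))
          (w (σ (e.symm (0, c))).1) (w (σ (e.symm (1, c))).1)) *
        ∏ a, if w (τN.symm a).1 = Sum.inl (Option.get (η (τN.symm a).1) (Option.ne_none_iff_isSome.mp (τN.symm a).2))
          then (1 : K) else 0 := by
  classical
  funext w
  rw [Finset.sum_apply]
  by_cases hw : ∃ u : {p // η p = none} → AT, w = join η u
  · obtain ⟨u, rfl⟩ := hw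
    rw [Finset.sum_eq_single_of_mem (fun t => u (σ t)) (Finset.mem_univ _)]
    · have hu : (fun q => (fun t => u (σ t)) (σ.symm q)) = u := funext fun q => by simp only [Equiv.apply_symm_apply]
      have hfree : (∏ a, if join η u (τN.symm a).1 =
          Sum.inl (Option.get (η (τN.symm a).1) (Option.ne_none_iff_isSome.mp (τN.symm a).2)) then (1 : K) else 0) = 1 := by
        refine Finset.prod_eq_one fun a _ => ?_
        obtain ⟨x, hx⟩ := Option.ne_none_iff_exists'.mp (τN.symm a).2
        obtain ⟨h', hget⟩ := Option.eq_some_iff_get_eq.mp hx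
        rw [join_apply_of_eq_some _ _ hx, if_pos]
        rw [hget]
      rw [hu, Pi.smul_apply, smul_eq_mul, if_pos rfl, mul_one, hfree, mul_one, taggedContraction_apply]
      exact Finset.prod_congr rfl fun c _ => by
        rw [join_apply_of_eq_none η u, join_apply_of_eq_none η u, Matrix.fromBlocks_apply₂₂]
    · intro v _ hv
      rw [Pi.smul_apply, smul_eq_mul, if_neg, mul_zero]
      intro huv
      apply hv
      funext t
      have h := congr_fun (join_injective η huv) (σ t)
      rw [Equiv.symm_apply_apply] at h
      exact h.symm
  · -- `w` is off every slice of profile `η`: both sides vanish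
    rw [Finset.sum_eq_zero fun v _ => by rw [Pi.smul_apply, smul_eq_mul, if_neg (fun h => hw ⟨_, h⟩), mul_zero]]
    symm
    by_contra hne
    refine hw (exists_eq_join η w (fun q => ?_) (fun p x hx => ?_))
    · -- a `T`-position with an `inl`-letter kills a pair factor
      rcases hwq : w q.1 with x | y
      · refine absurd (mul_eq_zero_of_left (Finset.prod_eq_zero (Finset.mem_univ (e (σ.symm q)).2) ?_) _) hne
        apply fromBlocks_zero_apply_eq_zero
        by_cases hi : (e (σ.symm q)).1 = 0
        · left
          have hq : σ (e.symm (0, (e (σ.symm q)).2)) = q := by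
            rw [← hi, Prod.mk.eta, Equiv.symm_apply_apply, Equiv.apply_symm_apply]
          rw [hq, hwq, Sum.isLeft_inl]
        · right
          have hq : σ (e.symm (1, (e (σ.symm q)).2)) = q := by
            rw [← Fin.eq_one_of_ne_zero _ hi, Prod.mk.eta, Equiv.symm_apply_apply, Equiv.apply_symm_apply]
          rw [hq, hwq, Sum.isLeft_inl]
      · exact ⟨y, rfl⟩
    · -- an `N`-position with the wrong letter kills a free-slot factor
      by_contra hwp
      refine absurd (mul_eq_zero_of_right _ (Finset.prod_eq_zero (Finset.mem_univ (τN ⟨p, by rw [hx]; simp⟩)) ?_)) hne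
      rw [if_neg]
      intro h'
      apply hwp
      rw [Equiv.symm_apply_apply] at h'
      rw [h']
      obtain ⟨h'', hget⟩ := Option.eq_some_iff_get_eq.mp hx
      rw [hget]

end Reassembly

end Summit.HodgeConjecture.HodgeConjecture.Theorems.Q8SymplecticPowersBlockSlices

end
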